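import Summits.KontsevichZagierPeriods.KontsevichZagierPeriods.Theses.Grothendieck
import Literature.NumberTheory.Transcendental.KZRulesAssociator

/-!
# Birth skeleton — piece GEN `GenericRealPoint` of the split of `Grothendieck.SectorComplement`

`GenericRealPoint := ∀ x : P, evalP x = 0 → ∃ u, evalP u ≠ 0 ∧ ∃ n, u * x ^ n = 0`
(`P = KZ.FormalPeriodRing`): the real-period point `𝔨 = ker evalP` is a minimal prime of `P`.

LINE "dimension count closes GEN sector by sector" — route Grothendieck's own mechanism with the
PRIME-ideal requirement of `LemniscaticSectorGlue` (8612) relaxed to a DIMENSION requirement: to put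
a value-zero formal period `x` under GEN it suffices to exhibit finitely many formal periods
`p₁ … p_m` with `x ∈ ℤ[p]`, a transcendence LOWER bound `d` for their values, and `m − d`
ACCESSIBLE polynomial relations (`Gⱼ(p) = 0` in `P`, i.e. move chains) whose Jacobian at the real
point has full rank — a SMOOTH-POINT CERTIFICATE. No primality / radicality of the accessible
ideal is needed (that difference is exactly the other two pieces CAN ∧ RED of the split).

* `stub_smoothPointCertificates` (conjecture-grade, the transcendence + accessibility input:
  numeric GPC for the rules, sector by sector, in Jacobian form — numerically CHECKABLE per
  proposed sector: values to 50 digits + a rank computation);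
* `stub_jacobianToMinimal` (pure commutative algebra, L: full-rank Jacobian of `h` relations at a
  point of transcendence degree `≥ m − h` ⇒ the point's prime is minimal over the relations — the
  Jacobian criterion: the relations are a regular system of parameters of `ℚ[X]_𝔮`);
* ENGINE, proved here: `gen_of_minimalCertificate` (a certificate whose real point is minimal over
  the accessible ideal puts `x` under GEN: `exists_mul_pow_mem_of_minimal` + push-forward along
  `aeval p`), and the composition `GenericRealPoint_of`.
-/

noncomputable section

set_option linter.dupNamespace false

namespace Summit.KontsevichZagierPeriods.KontsevichZagierPeriods.Cruxes.SectorComplement.StrategistR1.GenBirth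

open Literature.NumberTheory.Transcendental KZ

/-- GEN (the piece; route decl `Grothendieck.GenericRealPoint` after the split). -/
def GenericRealPoint : Prop :=
  ∀ x : FormalPeriodRing, evalP x = 0 → ∃ u : FormalPeriodRing, evalP u ≠ 0 ∧ ∃ n : ℕ, u * x ^ n = 0

/-- The real point of a finite family of formal periods: `ξᵢ = evalP pᵢ`. -/
abbrev realPoint {m : ℕ} (p : Fin m → FormalPeriodRing) : Fin m → ℝ := fun i => evalP (p i)

/-- `𝔮(ξ)`: the prime of integer polynomials vanishing at a real point `ξ`. -/
abbrev pointIdeal {m : ℕ} (ξ : Fin m → ℝ) : Ideal (MvPolynomial (Fin m) ℤ) :=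
  RingHom.ker (MvPolynomial.aeval ξ : MvPolynomial (Fin m) ℤ →ₐ[ℤ] ℝ).toRingHom

/-- MINIMALITY of the real point over an ideal `J` of accessible relations: every prime between
`J` and `𝔮(ξ)` is `𝔮(ξ)` (the real point is a generic point of `V(J)`). -/
def MinimalOver {m : ℕ} (J : Ideal (MvPolynomial (Fin m) ℤ)) (ξ : Fin m → ℝ) : Prop :=
  ∀ 𝔭 : Ideal (MvPolynomial (Fin m) ℤ), 𝔭.IsPrime → J ≤ 𝔭 → 𝔭 ≤ pointIdeal ξ → pointIdeal ξ ≤ 𝔭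

/-- **stub (transcendence + accessibility input) — SMOOTH-POINT CERTIFICATES.** Every value-zero
formal period `x` lies in a finitely generated subring `ℤ[p₁,…,p_{d+h}]` of `P` whose values have
transcendence degree `≥ d` (the first `d` values are algebraically independent over `ℚ`) and which
carries `h` accessible relations `Gⱼ(p) = 0` in `P` whose Jacobian `(∂Gⱼ/∂Xᵢ)(ξ)` at the real point
has rank `h`. Numeric GPC for the rules in Jacobian form, sector by sector. -/
theorem stub_smoothPointCertificates :
    ∀ x : FormalPeriodRing, evalP x = 0 →
      ∃ (d h : ℕ) (p : Fin (d + h) → FormalPeriodRing) (F : MvPolynomial (Fin (d + h)) ℤ)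
        (G : Fin h → MvPolynomial (Fin (d + h)) ℤ),
        MvPolynomial.aeval p F = x ∧ (∀ j, MvPolynomial.aeval p (G j) = 0) ∧
        AlgebraicIndependent ℚ (fun i : Fin d => evalP (p (Fin.castAdd h i))) ∧
        (Matrix.of fun j i => MvPolynomial.aeval (realPoint p) (MvPolynomial.pderiv i (G j))).rank = h := by
  sorry

/-- **stub (pure commutative algebra, L) — JACOBIAN CRITERION ⇒ MINIMALITY.** At a real point `ξ`
of transcendence degree `≥ d` over `ℚ`, `h` integer polynomials in `d + h` variables vanishing at
`ξ` with Jacobian of rank `h` at `ξ` generate, locally at `𝔮(ξ)`, the whole prime `𝔮(ξ)`; in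
particular `𝔮(ξ)` is minimal over the ideal they span. (Regular system of parameters of the regular
local ring `ℚ[X]_𝔮`, `ht 𝔮 = d + h − trdeg ≤ h`.) -/
theorem stub_jacobianToMinimal :
    ∀ (d h : ℕ) (ξ : Fin (d + h) → ℝ) (G : Fin h → MvPolynomial (Fin (d + h)) ℤ),
      (∀ j, MvPolynomial.aeval ξ (G j) = 0) →
      AlgebraicIndependent ℚ (fun i : Fin d => ξ (Fin.castAdd h i)) →
      (Matrix.of fun j i => MvPolynomial.aeval ξ (MvPolynomial.pderiv i (G j))).rank = h →
      MinimalOver (Ideal.span (Set.range G)) ξ := by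
  sorry

/-! ## Engine (proved) -/

/-- Elementwise form of "the prime `q` is minimal over `J`": every element of `q` is killed,
after a power, by an element outside `q`, modulo `J`. (If no `S · Fⁿ` lies in `J`, a prime over `J`
avoiding the multiplicative set generated by `q`-complement and `F` sits inside `q` and misses `F`;
the hypothesis `J ≤ q` is implied and not needed.)
[folklore] -/
theorem exists_mul_pow_mem_of_minimal {R : Type*} [CommRing R] (J q : Ideal R) [hq : q.IsPrime]
    (hmin : ∀ 𝔭 : Ideal R, 𝔭.IsPrime → J ≤ 𝔭 → 𝔭 ≤ q → q ≤ 𝔭) {F : R} (hF : F ∈ q) :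
    ∃ S ∉ q, ∃ n : ℕ, S * F ^ n ∈ J := by
  by_contra hcon
  push Not at hcon
  let M : Submonoid R := q.primeCompl ⊔ Submonoid.powers F
  have hdisj : Disjoint (J : Set R) (M : Set R) := by
    rw [Set.disjoint_left]
    intro z hz hzM
    obtain ⟨S, hS, w, hw, hSw⟩ := Submonoid.mem_sup.mp hzM
    obtain ⟨n, rfl⟩ := hw
    exact hcon S (Ideal.mem_primeCompl_iff.mp hS) n (hSw ▸ hz)
  obtain ⟨𝔭, h𝔭, hJ𝔭, h𝔭M⟩ := Ideal.exists_le_prime_disjoint J M hdisj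
  have h𝔭q : 𝔭 ≤ q := by
    intro z hz
    by_contra hzq
    exact Set.disjoint_left.mp h𝔭M hz (Submonoid.mem_sup_left (Ideal.mem_primeCompl_iff.mpr hzq))
  have hF𝔭 : F ∉ 𝔭 := fun h =>
    Set.disjoint_left.mp h𝔭M h (Submonoid.mem_sup_right (Submonoid.mem_powers F))
  exact hF𝔭 (hmin 𝔭 h𝔭 hJ𝔭 h𝔭q hF)

/-- `evalP ∘ aeval p = aeval ξ` on integer polynomials (`ξ` the real point of `p`). [folklore] -/
theorem evalP_aeval {m : ℕ} (p : Fin m → FormalPeriodRing) (H : MvPolynomial (Fin m) ℤ) :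
    evalP (MvPolynomial.aeval p H) = MvPolynomial.aeval (realPoint p) H := by
  have h : evalP.comp (MvPolynomial.aeval p).toRingHom =
      (MvPolynomial.aeval (realPoint p) : MvPolynomial (Fin m) ℤ →ₐ[ℤ] ℝ).toRingHom := by
    refine MvPolynomial.ringHom_ext (fun z => ?_) (fun i => ?_)
    · simp
    · simp [realPoint]
  exact RingHom.congr_fun h H

/-- **ENGINE — a minimal-point certificate puts `x` under GEN.** If `x = F(p)` for finitely many
formal periods `p`, an ideal `J` of accessible relations (`G(p) = 0` in `P` for `G ∈ J`) and the
real point minimal over `J`, then some `u = S(p)` of non-zero value kills a power of `x`: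
`S ∉ 𝔮`, `S·Fⁿ ∈ J` (`exists_mul_pow_mem_of_minimal`), pushed forward along `aeval p`. [folklore] -/
theorem gen_of_minimalCertificate (x : FormalPeriodRing) {m : ℕ} (p : Fin m → FormalPeriodRing)
    (F : MvPolynomial (Fin m) ℤ) (J : Ideal (MvPolynomial (Fin m) ℤ))
    (hF : MvPolynomial.aeval p F = x) (hJ : ∀ G ∈ J, MvPolynomial.aeval p G = 0)
    (hx : evalP x = 0) (hmin : MinimalOver J (realPoint p)) :
    ∃ u : FormalPeriodRing, evalP u ≠ 0 ∧ ∃ n : ℕ, u * x ^ n = 0 := by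
  have hFq : F ∈ pointIdeal (realPoint p) := by
    change (MvPolynomial.aeval (realPoint p) : MvPolynomial (Fin m) ℤ →ₐ[ℤ] ℝ).toRingHom F = 0
    rw [AlgHom.toRingHom_eq_coe, RingHom.coe_coe, ← evalP_aeval, hF, hx]
  haveI : (pointIdeal (realPoint p)).IsPrime := RingHom.ker_isPrime _
  obtain ⟨S, hS, n, hn⟩ := exists_mul_pow_mem_of_minimal J (pointIdeal (realPoint p)) hmin hFq
  refine ⟨MvPolynomial.aeval p S, ?_, n, ?_⟩
  · intro h0
    apply hS
    change (MvPolynomial.aeval (realPoint p) : MvPolynomial (Fin m) ℤ →ₐ[ℤ] ℝ).toRingHom S = 0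
    rw [AlgHom.toRingHom_eq_coe, RingHom.coe_coe, ← evalP_aeval, h0]
  · have := hJ _ hn
    rwa [map_mul, map_pow, hF] at this

/-- **Composition**: the two stubs give GEN. -/
theorem GenericRealPoint_of
    (h₁ : ∀ x : FormalPeriodRing, evalP x = 0 →
      ∃ (d h : ℕ) (p : Fin (d + h) → FormalPeriodRing) (F : MvPolynomial (Fin (d + h)) ℤ)
        (G : Fin h → MvPolynomial (Fin (d + h)) ℤ),
        MvPolynomial.aeval p F = x ∧ (∀ j, MvPolynomial.aeval p (G j) = 0) ∧
        AlgebraicIndependent ℚ (fun i : Fin d => evalP (p (Fin.castAdd h i))) ∧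
        (Matrix.of fun j i => MvPolynomial.aeval (realPoint p) (MvPolynomial.pderiv i (G j))).rank = h)
    (h₂ : ∀ (d h : ℕ) (ξ : Fin (d + h) → ℝ) (G : Fin h → MvPolynomial (Fin (d + h)) ℤ),
      (∀ j, MvPolynomial.aeval ξ (G j) = 0) →
      AlgebraicIndependent ℚ (fun i : Fin d => ξ (Fin.castAdd h i)) →
      (Matrix.of fun j i => MvPolynomial.aeval ξ (MvPolynomial.pderiv i (G j))).rank = h →
      MinimalOver (Ideal.span (Set.range G)) ξ) :
    GenericRealPoint := by
  intro x hx
  obtain ⟨d, h, p, F, G, hF, hG, hind, hrank⟩ := h₁ x hx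
  have hGξ : ∀ j, MvPolynomial.aeval (realPoint p) (G j) = 0 := fun j => by
    rw [← evalP_aeval, hG j, map_zero]
  have hmin : MinimalOver (Ideal.span (Set.range G)) (realPoint p) := h₂ d h (realPoint p) G hGξ hind hrank
  refine gen_of_minimalCertificate x p F (Ideal.span (Set.range G)) hF ?_ hx hmin
  intro H hH
  -- `aeval p` kills the span of the `G j`
  have hle : Ideal.span (Set.range G) ≤ RingHom.ker (MvPolynomial.aeval p).toRingHom := by
    rw [Ideal.span_le]
    rintro _ ⟨j, rfl⟩
    exact hG j
  exact hle hH

/-- The composition instantiated with the stubs. -/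
theorem GenericRealPoint_of_stubs : GenericRealPoint :=
  GenericRealPoint_of stub_smoothPointCertificates stub_jacobianToMinimal

end Summit.KontsevichZagierPeriods.KontsevichZagierPeriods.Cruxes.SectorComplement.StrategistR1.GenBirth
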